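import Summits.ValiantsHypothesis.ValiantsHypothesis.Theorems.AnyonJetsPencilVNP0
import Summits.ValiantsHypothesis.ValiantsHypothesis.Theorems.AnyonJetsUniformJetUpperBoundStubJetTaylor
import Summits.ValiantsHypothesis.ValiantsHypothesis.Theorems.AnyonJetsTwoAdicShadow
import Summits.ValiantsHypothesis.ValiantsHypothesis.Theorems.AnyonJetsConstantFreeJetGrowthDefs
import Literature.Computability.AlgebraicComplexity.HomogeneousComponentsConstantFree
import Literature.Computability.AlgebraicComplexity.ConstantFreeCircuits
import Literature.Computability.AlgebraicComplexity.PermanentVNP0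
import Literature.Barriers.ValiantsHypothesis.BIJL18PermanentZero
import HarnessLib

/-!
# AnyonJets — crux `JetConstantElim` (stmt-16737), line `birth`, stub `stub_multiplierRemoval`:
# the UPPER half of the calibration — under `VP⁰ = VNP⁰` every anyonic jet is uniformly cheap

Route `ValiantsHypothesis/AnyonJets`.  The registered stub `stub_multiplierRemoval` (`MR`:
`τ(J_(n,k)) ≤ (τ(M·J_(n,k)) + n + 2)^{b₃}` uniformly in `k ≤ log₂ n`, `M ≥ 1`) of the aside crux
`JetConstantElim` (`CE`) is conjecture-grade; the landed calibration
(`…MultiplierRemovalCalibration.lean`, `…MultiplierRemovalPerEasy.lean`) gives the LOWER half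
`MR ∧ CF ⊢ τ(PER) ≠ n^{O(1)}` (proving the stub, jointly with the sibling crux, proves a
constant-free lower bound for the permanent).  THIS file gives the UPPER half, against the tree's
named class collapse `VP0EqVNP0 : ∀ F, IsVNP0Family F.poly → IsVP0Family F.poly`
(`Literature/Barriers/ValiantsHypothesis/BIJL18PermanentZero.lean`):

* `isPBounded_tau_pencil_of_vp0EqVNP0` — under `VP⁰ = VNP⁰` the inversion pencil
  `P_n(q;X) = Σ_σ q^{inv σ} Π X_{σ i,i}` (a `VNP⁰` family, `UniformJet.isVNP0Family_pencil`) has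
  `τ(P_n) = n^{O(1)}`;
* `aeval_homogeneousComponent_shiftedPencil` — the jets are homogeneous components: with
  `F_n = P_n(u - 1; X)`, `J_(n,k) = (-1)^k · F_n^{(n+k)}(u := 1)` (every monomial of `F_n` has
  `X`-degree `n`, so total degree `n + k` singles out `u^k`; then `stub_jetTaylor`'s identity);
* `uniformTau_of_vp0EqVNP0` — **`VP⁰ = VNP⁰ ⟹ ∃ c ∀ n ∀ k, τ(J_(n,k)) ≤ (n+2)^c`** (shift costs
  `2`, the homogeneous component `(n+k+2)²·τ` by the NEW constant-free BCS Lemma (21.25)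
  `constantFreeComplexity_homogeneousComponent_le`, the evaluation `u := 1` and the sign nothing;
  `J_(n,k) = 0` for `k > n(n-1)/2`, `AnyonJets.jet_eq_zero_of_lt`);
* consequences BY NAME: `multiplierRemoval_of_vp0EqVNP0` (**`VP⁰ = VNP⁰ ⟹ MR`**, signature
  verbatim), `jetConstantElim_of_vp0EqVNP0` (`⟹ CE`, item 16737),
  `jetConstantElimTwoAdic_of_vp0EqVNP0` (`⟹` item 23655),
  `not_constantFreeJetGrowth_of_vp0EqVNP0` (`⟹ ¬CF`, item 16738),
  `not_constantFreeJetGrowthUltimate_of_vp0EqVNP0` (`⟹ ¬` item 23656),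
  `not_perModPowBooleanHard_of_vp0EqVNP0`; contrapositives `not_vp0EqVNP0_of_not_multiplierRemoval`
  (**a refutation of the stub PROVES `VP⁰ ≠ VNP⁰`**), `not_vp0EqVNP0_of_not_jetConstantElim`,
  `not_vp0EqVNP0_of_constantFreeJetGrowth` (**the aside crux `CF` alone proves `VP⁰ ≠ VNP⁰`**).

Reading (the stub is LOCKED BOTH WAYS): `VP⁰ = VNP⁰ ⟹ MR` and `MR ∧ CF ⟹ τ(PER)` superpolynomial
(`not_isPBounded_tau_per_of_multiplierRemoval_of_cfGrowth`); so refuting `MR` is at least as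
hard as separating `VP⁰` from `VNP⁰`, and proving it (in the only world the route can use, `CF`)
at least as hard as a superpolynomial constant-free lower bound for the permanent.  Honest
framing: CONDITIONAL implications and calibration only; `MR`, `CE`, `CF` stay open; VP ≠ VNP is
NOT proved here and is not moved.

References: Bürgisser 2009 §2.2 (`VP⁰`, `VNP⁰`, `τ`); BCS 1997 Lemma (21.25); Bläser–Ikenmeyer–
Jindal–Lysikov 2018 Def. 29 (`VP⁰ = VNP⁰`); Koiran–Perifel 2011 Rem. 4.
-/

noncomputable section

-- single-conjunct layout: Sub = Summit, duplicated namespace component intended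
set_option linter.dupNamespace false

namespace Summit.ValiantsHypothesis.ValiantsHypothesis.Theorems.AnyonJets.JetConstantElim

open MvPolynomial Finset Literature.Computability.AlgebraicComplexity
open Literature.Barriers.ValiantsHypothesis (VP0EqVNP0)
open Summit.ValiantsHypothesis.ValiantsHypothesis.Theorems.AnyonJets.ConstantFreeJetGrowth (jet)

namespace VP0Collapse

/-! ### Under `VP⁰ = VNP⁰` the inversion pencil is constant-free cheap -/

/-- **`VP⁰ = VNP⁰ ⟹ τ(P_n) = n^{O(1)}`** for the inversion pencil
`P_n = Σ_σ (X none)^{inv σ} Π_i X (some (σ i, i))` (a `VNP⁰` family by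
`UniformJet.isVNP0Family_pencil`; bundle it as a `PolyFamily ℤ` along `Fintype.equivFin`, apply the
collapse, rename back). [cite: Burgisser2006, Def. 2.7] -/
theorem isPBounded_tau_pencil_of_vp0EqVNP0 (h : VP0EqVNP0) :
    IsPBounded fun n => constantFreeComplexity
      (∑ σ : Equiv.Perm (Fin n), (X none : MvPolynomial (Option (Fin n × Fin n)) ℤ) ^
          (univ.filter (fun p : Fin n × Fin n => p.1 < p.2 ∧ σ p.2 < σ p.1)).card *
        ∏ i : Fin n, X (some (σ i, i))) := by
  set P : ∀ n : ℕ, MvPolynomial (Option (Fin n × Fin n)) ℤ := fun n =>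
    ∑ σ : Equiv.Perm (Fin n), (X none : MvPolynomial (Option (Fin n × Fin n)) ℤ) ^
        (univ.filter (fun p : Fin n × Fin n => p.1 < p.2 ∧ σ p.2 < σ p.1)).card *
      ∏ i : Fin n, X (some (σ i, i)) with hP
  have hcardFin :
      IsPBounded fun n => Fintype.card (Fin (Fintype.card (Option (Fin n × Fin n)))) := by
    refine (IsPBounded.iff_exists_le_mul_succ_pow _).2 ⟨1, 2, fun n => ?_⟩
    simp only [Fintype.card_fin, Fintype.card_option, Fintype.card_prod]
    nlinarith
  have hVNP : IsVNP0Family (σ := fun n => Fin (Fintype.card (Option (Fin n × Fin n))))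
      fun n => rename (Fintype.equivFin (Option (Fin n × Fin n))) (P n) :=
    (UniformJet.isVNP0Family_pencil).rename (fun n => Fintype.equivFin (Option (Fin n × Fin n)))
      hcardFin
  have hVP := h ⟨fun n => Fintype.card (Option (Fin n × Fin n)),
    fun n => rename (Fintype.equivFin (Option (Fin n × Fin n))) (P n)⟩ hVNP
  have hcard : IsPBounded fun n => Fintype.card (Option (Fin n × Fin n)) := by
    refine (IsPBounded.iff_exists_le_mul_succ_pow _).2 ⟨1, 2, fun n => ?_⟩
    simp only [Fintype.card_option, Fintype.card_prod, Fintype.card_fin]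
    nlinarith
  have hVP' := hVP.rename (fun n => ((Fintype.equivFin (Option (Fin n × Fin n))).symm :
    Fin (Fintype.card (Option (Fin n × Fin n))) → Option (Fin n × Fin n))) hcard
  have e : (fun n => rename ((Fintype.equivFin (Option (Fin n × Fin n))).symm :
      Fin (Fintype.card (Option (Fin n × Fin n))) → Option (Fin n × Fin n))
      (rename (Fintype.equivFin (Option (Fin n × Fin n))) (P n))) = P := by
    funext n
    rw [rename_rename, Equiv.symm_comp_self, rename_id]
    rfl
  rw [e] at hVP'
  exact hVP'.isPBounded_constantFreeComplexity

/-! ### The shift `q ↦ u - 1` costs two gates -/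

/-- **`τ(F_n) ≤ τ(P_n) + 2`** for the shifted pencil `F_n = P_n(u - 1; X)` (substitution bound
`constantFreeComplexity_aeval_le`; `τ(u - 1) ≤ 2`). [cite: Burgisser2000, Rem. 2.7] -/
theorem tau_shiftedPencil_le (n : ℕ) :
    constantFreeComplexity (∑ σ : Equiv.Perm (Fin n),
        ((X none : MvPolynomial (Option (Fin n × Fin n)) ℤ) - 1) ^
            (univ.filter (fun p : Fin n × Fin n => p.1 < p.2 ∧ σ p.2 < σ p.1)).card *
          ∏ i : Fin n, X (some (σ i, i))) ≤
      constantFreeComplexity (∑ σ : Equiv.Perm (Fin n),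
        (X none : MvPolynomial (Option (Fin n × Fin n)) ℤ) ^
            (univ.filter (fun p : Fin n × Fin n => p.1 < p.2 ∧ σ p.2 < σ p.1)).card *
          ∏ i : Fin n, X (some (σ i, i))) + 2 := by
  set g : Option (Fin n × Fin n) → MvPolynomial (Option (Fin n × Fin n)) ℤ :=
    fun o => Option.elim o (X none - 1) (fun p => X (some p)) with hg
  have hF : aeval g (∑ σ : Equiv.Perm (Fin n),
        (X none : MvPolynomial (Option (Fin n × Fin n)) ℤ) ^
            (univ.filter (fun p : Fin n × Fin n => p.1 < p.2 ∧ σ p.2 < σ p.1)).card *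
          ∏ i : Fin n, X (some (σ i, i))) =
      ∑ σ : Equiv.Perm (Fin n),
        ((X none : MvPolynomial (Option (Fin n × Fin n)) ℤ) - 1) ^
            (univ.filter (fun p : Fin n × Fin n => p.1 < p.2 ∧ σ p.2 < σ p.1)).card *
          ∏ i : Fin n, X (some (σ i, i)) := by
    simp only [map_sum, map_mul, map_pow, map_prod, aeval_X, hg, Option.elim]
  rw [← hF]
  refine (constantFreeComplexity_aeval_le _ g).trans (Nat.add_le_add_left ?_ _)
  have hsum : ∑ o : Option (Fin n × Fin n), constantFreeComplexity (g o) =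
      constantFreeComplexity (g none) := by
    rw [Fintype.sum_option]
    simp [hg, constantFreeComplexity_X]
  rw [hsum]
  calc constantFreeComplexity (g none)
      = constantFreeComplexity ((X none : MvPolynomial (Option (Fin n × Fin n)) ℤ) - 1) := rfl
    _ ≤ constantFreeComplexity (X none : MvPolynomial (Option (Fin n × Fin n)) ℤ) +
          constantFreeComplexity (1 : MvPolynomial (Option (Fin n × Fin n)) ℤ) + 2 :=
        constantFreeComplexity_sub_le _ _
    _ = 2 := by rw [constantFreeComplexity_X, constantFreeComplexity_one]

/-! ### The jets are homogeneous components of the shifted pencil -/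

/-- The monomial `u^m · Π_i X_{σ i, i}` is homogeneous of degree `m + n`. [folklore] -/
theorem isHomogeneous_upow_mul_perm (n m : ℕ) (σ : Equiv.Perm (Fin n)) :
    ((X none : MvPolynomial (Option (Fin n × Fin n)) ℤ) ^ m *
        ∏ i : Fin n, X (some (σ i, i))).IsHomogeneous (m + n) := by
  have h1 : ((X none : MvPolynomial (Option (Fin n × Fin n)) ℤ) ^ m).IsHomogeneous (1 * m) :=
    (isHomogeneous_X ℤ none).pow m
  have h2 : (∏ i : Fin n, (X (some (σ i, i)) :
      MvPolynomial (Option (Fin n × Fin n)) ℤ)).IsHomogeneous (∑ i : Fin n, 1) :=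
    IsHomogeneous.prod univ _ (fun _ => 1) fun i _ => isHomogeneous_X ℤ (some (σ i, i))
  have h := h1.mul h2
  simpa using h

/-- **Binomial expansion of the shifted pencil** into homogeneous pieces:
`F_n = Σ_σ Σ_{m ≤ inv σ} C((-1)^{inv σ - m} binom(inv σ, m)) · (u^m Π_i X_{σ i,i})`. [folklore] -/
theorem shiftedPencil_eq_sum (n : ℕ) :
    (∑ σ : Equiv.Perm (Fin n),
        ((X none : MvPolynomial (Option (Fin n × Fin n)) ℤ) - 1) ^
            (univ.filter (fun p : Fin n × Fin n => p.1 < p.2 ∧ σ p.2 < σ p.1)).card *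
          ∏ i : Fin n, X (some (σ i, i))) =
      ∑ σ : Equiv.Perm (Fin n),
        ∑ m ∈ range ((univ.filter (fun p : Fin n × Fin n => p.1 < p.2 ∧ σ p.2 < σ p.1)).card + 1),
          C ((-1 : ℤ) ^
                ((univ.filter (fun p : Fin n × Fin n => p.1 < p.2 ∧ σ p.2 < σ p.1)).card - m) *
              (((univ.filter (fun p : Fin n × Fin n => p.1 < p.2 ∧ σ p.2 < σ p.1)).card.choose m :
                ℕ) : ℤ)) *
            ((X none : MvPolynomial (Option (Fin n × Fin n)) ℤ) ^ m *
              ∏ i : Fin n, X (some (σ i, i))) := by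
  refine Finset.sum_congr rfl fun σ _ => ?_
  set I := (univ.filter (fun p : Fin n × Fin n => p.1 < p.2 ∧ σ p.2 < σ p.1)).card with hI
  set M := ∏ i : Fin n, (X (some (σ i, i)) : MvPolynomial (Option (Fin n × Fin n)) ℤ) with hM
  rw [sub_eq_add_neg, add_pow, Finset.sum_mul]
  refine Finset.sum_congr rfl fun m _ => ?_
  simp only [map_mul, map_pow, map_neg, map_one, map_natCast]
  ring

/-- **The degree-`(n+k)` homogeneous component of the shifted pencil, evaluated at `u = 1`, is the
`u^k`-coefficient**: `F_n^{(n+k)}(u := 1) = Σ_σ (-1)^{inv σ - k} binom(inv σ, k) Π_i X_{σ i,i}`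
(`= [u^k] F_n`, `UniformJet.coeff_shiftedPencil`). [folklore] -/
theorem aeval_homogeneousComponent_shiftedPencil (n k : ℕ) :
    aeval (fun o : Option (Fin n × Fin n) => Option.elim o (1 : MvPolynomial (Fin n × Fin n) ℤ) X)
        (homogeneousComponent (n + k) (∑ σ : Equiv.Perm (Fin n),
          ((X none : MvPolynomial (Option (Fin n × Fin n)) ℤ) - 1) ^
              (univ.filter (fun p : Fin n × Fin n => p.1 < p.2 ∧ σ p.2 < σ p.1)).card *
            ∏ i : Fin n, X (some (σ i, i)))) =
      ∑ σ : Equiv.Perm (Fin n),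
        C ((-1 : ℤ) ^
              ((univ.filter (fun p : Fin n × Fin n => p.1 < p.2 ∧ σ p.2 < σ p.1)).card - k) *
            (((univ.filter (fun p : Fin n × Fin n => p.1 < p.2 ∧ σ p.2 < σ p.1)).card.choose k :
              ℕ) : ℤ)) *
          ∏ i : Fin n, X (σ i, i) := by
  rw [shiftedPencil_eq_sum, map_sum, map_sum]
  refine Finset.sum_congr rfl fun σ _ => ?_
  set I := (univ.filter (fun p : Fin n × Fin n => p.1 < p.2 ∧ σ p.2 < σ p.1)).card with hI
  rw [map_sum]
  -- only the piece `m = k` survives the homogeneous component of degree `n + k`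
  have hpiece : ∀ m ∈ range (I + 1),
      homogeneousComponent (n + k) (C ((-1 : ℤ) ^ (I - m) * ((I.choose m : ℕ) : ℤ)) *
          ((X none : MvPolynomial (Option (Fin n × Fin n)) ℤ) ^ m *
            ∏ i : Fin n, X (some (σ i, i)))) =
        if k = m then C ((-1 : ℤ) ^ (I - m) * ((I.choose m : ℕ) : ℤ)) *
          ((X none : MvPolynomial (Option (Fin n × Fin n)) ℤ) ^ m * ∏ i : Fin n, X (some (σ i, i)))
        else 0 := by
    intro m _
    rw [homogeneousComponent_C_mul, homogeneousComponent_of_mem (isHomogeneous_upow_mul_perm n m σ)]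
    by_cases hkm : k = m
    · subst hkm
      simp [Nat.add_comm]
    · have : n + k ≠ m + n := by omega
      simp [this, hkm]
  rw [Finset.sum_congr rfl hpiece, Finset.sum_ite_eq]
  by_cases hk : k ∈ range (I + 1)
  · rw [if_pos hk, map_mul, aeval_C, algebraMap_eq]
    congr 1
    simp only [map_mul, map_pow, map_prod, aeval_X, Option.elim, one_pow, one_mul]
  · rw [if_neg hk]
    have hlt : I < k := by
      rw [Finset.mem_range, not_lt] at hk
      omega
    rw [Nat.choose_eq_zero_of_lt hlt]
    simp

/-- **The jets are signed homogeneous components of the shifted pencil**: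
`J_(n,k) = (-1)^k • F_n^{(n+k)}(u := 1)` in `ℤ[X]` (from `UniformJet.map_jet_eq_smul_coeff` at
`K = ℤ` and `UniformJet.coeff_shiftedPencil`). [folklore] -/
theorem jet_eq_smul_aeval_homogeneousComponent (n k : ℕ) :
    jet n k = (-1 : ℤ) ^ k •
      aeval (fun o : Option (Fin n × Fin n) => Option.elim o (1 : MvPolynomial (Fin n × Fin n) ℤ) X)
        (homogeneousComponent (n + k) (∑ σ : Equiv.Perm (Fin n),
          ((X none : MvPolynomial (Option (Fin n × Fin n)) ℤ) - 1) ^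
              (univ.filter (fun p : Fin n × Fin n => p.1 < p.2 ∧ σ p.2 < σ p.1)).card *
            ∏ i : Fin n, X (some (σ i, i)))) := by
  rw [aeval_homogeneousComponent_shiftedPencil, ← UniformJet.coeff_shiftedPencil ℤ n k]
  have h := UniformJet.map_jet_eq_smul_coeff ℤ n k
  rw [Int.castRingHom_int, MvPolynomial.map_id] at h
  exact h

/-! ### The uniform bound -/

/-- **`τ(J_(n,k)) ≤ (n + k + 2)² · (τ(P_n) + 2) + 1`** for all `n, k`: shift (`+2`), homogeneous
component of degree `n + k` (`× (n+k+2)²`, constant-free BCS Lemma (21.25)), evaluation `u := 1`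
(free) and the sign `(-1)^k` (`+1`). [cite: BurgisserClausenShokrollahi1997, Lemma (21.25)] -/
theorem tau_jet_le_pencil (n k : ℕ) :
    constantFreeComplexity (jet n k) ≤
      (n + k + 2) ^ 2 * (constantFreeComplexity (∑ σ : Equiv.Perm (Fin n),
        (X none : MvPolynomial (Option (Fin n × Fin n)) ℤ) ^
            (univ.filter (fun p : Fin n × Fin n => p.1 < p.2 ∧ σ p.2 < σ p.1)).card *
          ∏ i : Fin n, X (some (σ i, i))) + 2) + 1 := by
  set F := ∑ σ : Equiv.Perm (Fin n),
        ((X none : MvPolynomial (Option (Fin n × Fin n)) ℤ) - 1) ^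
            (univ.filter (fun p : Fin n × Fin n => p.1 < p.2 ∧ σ p.2 < σ p.1)).card *
          ∏ i : Fin n, X (some (σ i, i)) with hFdef
  set ρ : Option (Fin n × Fin n) → MvPolynomial (Fin n × Fin n) ℤ :=
    fun o => Option.elim o (1 : MvPolynomial (Fin n × Fin n) ℤ) X with hρ
  set G := aeval ρ (homogeneousComponent (n + k) F) with hG
  -- the evaluation `u := 1` is free
  have hGle :
      constantFreeComplexity G ≤ constantFreeComplexity (homogeneousComponent (n + k) F) := by
    refine (constantFreeComplexity_aeval_le _ ρ).trans (le_of_eq ?_)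
    have hsum : ∑ o : Option (Fin n × Fin n), constantFreeComplexity (ρ o) = 0 := by
      rw [Fintype.sum_option]
      simp [hρ, constantFreeComplexity_X, constantFreeComplexity_one]
    rw [hsum, add_zero]
  -- the sign costs at most one gate
  have hsign : constantFreeComplexity (jet n k) ≤ constantFreeComplexity G + 1 := by
    rw [jet_eq_smul_aeval_homogeneousComponent, ← hFdef, ← hρ, ← hG]
    rcases Nat.even_or_odd k with he | ho
    · rw [he.neg_one_pow, one_smul]; exact Nat.le_succ _
    · rw [ho.neg_one_pow, neg_one_smul]; exact constantFreeComplexity_neg_le G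
  calc constantFreeComplexity (jet n k) ≤ constantFreeComplexity G + 1 := hsign
    _ ≤ constantFreeComplexity (homogeneousComponent (n + k) F) + 1 := Nat.add_le_add_right hGle 1
    _ ≤ (n + k + 2) ^ 2 * constantFreeComplexity F + 1 :=
        Nat.add_le_add_right (constantFreeComplexity_homogeneousComponent_le F (n + k)) 1
    _ ≤ _ := by
        refine Nat.add_le_add_right (Nat.mul_le_mul_left _ ?_) 1
        rw [hFdef]
        exact tau_shiftedPencil_le n

/-- Arithmetic: `(n + k + 2)² (a (n+1)^b + 2) + 1 ≤ (n + 2)^(a + b + 7)` for `k ≤ n(n-1)/2`.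
[folklore] -/
theorem bound_arith (a b n k : ℕ) (hk : k ≤ n * (n - 1) / 2) :
    (n + k + 2) ^ 2 * (a * (n + 1) ^ b + 2) + 1 ≤ (n + 2) ^ (a + b + 7) := by
  have hX : 2 ≤ n + 2 := by omega
  have hk2 : k ≤ n * n := by
    refine hk.trans ((Nat.div_le_self _ _).trans ?_)
    exact Nat.mul_le_mul_left _ (Nat.sub_le _ _)
  have h1 : n + k + 2 ≤ (n + 2) ^ 2 := by nlinarith
  have h2 : (n + k + 2) ^ 2 ≤ (n + 2) ^ 4 := by
    calc (n + k + 2) ^ 2 ≤ ((n + 2) ^ 2) ^ 2 := Nat.pow_le_pow_left h1 2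
      _ = (n + 2) ^ 4 := by rw [← pow_mul]
  have h3 : a * (n + 1) ^ b + 2 ≤ (a + 2) * (n + 2) ^ b := by
    have hb1 : (n + 1) ^ b ≤ (n + 2) ^ b := Nat.pow_le_pow_left (by omega) b
    have hb2 : 1 ≤ (n + 2) ^ b := Nat.one_le_pow _ _ (by omega)
    nlinarith
  have h4 : a + 2 ≤ (n + 2) ^ (a + 2) :=
    le_trans (Nat.lt_two_pow_self).le (Nat.pow_le_pow_left hX _)
  have h5 : 1 ≤ (n + 2) ^ (a + b + 6) := Nat.one_le_pow _ _ (by omega)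
  calc (n + k + 2) ^ 2 * (a * (n + 1) ^ b + 2) + 1
      ≤ (n + 2) ^ 4 * ((a + 2) * (n + 2) ^ b) + 1 := by gcongr
    _ ≤ (n + 2) ^ 4 * ((n + 2) ^ (a + 2) * (n + 2) ^ b) + (n + 2) ^ (a + b + 6) := by gcongr
    _ = (n + 2) ^ (a + b + 6) + (n + 2) ^ (a + b + 6) := by ring
    _ = (n + 2) ^ (a + b + 6) * 2 := by ring
    _ ≤ (n + 2) ^ (a + b + 6) * (n + 2) := Nat.mul_le_mul_left _ hX
    _ = (n + 2) ^ (a + b + 7) := by ring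

end VP0Collapse

open VP0Collapse

/-- **`VP⁰ = VNP⁰ ⟹` every anyonic jet is constant-free cheap, UNIFORMLY in the order**:
`∃ c, ∀ n k, τ(J_(n,k)) ≤ (n + 2)^c` (all `k`, not only the window `k ≤ log₂ n`).  Pencil in
`VP⁰` under the collapse, jets = signed homogeneous components of the shifted pencil, components
constant-free cheap. [cite: Burgisser2006, Def. 2.7] -/
theorem uniformTau_of_vp0EqVNP0 (h : VP0EqVNP0) :
    ∃ c : ℕ, ∀ n k : ℕ, constantFreeComplexity (jet n k) ≤ (n + 2) ^ c := by
  obtain ⟨a, b, hab⟩ := (IsPBounded.iff_exists_le_mul_succ_pow _).1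
    (isPBounded_tau_pencil_of_vp0EqVNP0 h)
  refine ⟨a + b + 7, fun n k => ?_⟩
  rcases Nat.lt_or_ge (n * (n - 1) / 2) k with hk | hk
  · -- `J_(n,k) = 0` beyond the top order (`AnyonJets.jet_eq_zero_of_lt`, TwoAdicShadow file)
    have h0 : jet n k = 0 := AnyonJets.jet_eq_zero_of_lt hk
    rw [h0, constantFreeComplexity_zero]; exact Nat.zero_le _
  · calc constantFreeComplexity (jet n k)
        ≤ (n + k + 2) ^ 2 * (constantFreeComplexity (∑ σ : Equiv.Perm (Fin n),
            (X none : MvPolynomial (Option (Fin n × Fin n)) ℤ) ^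
                (univ.filter (fun p : Fin n × Fin n => p.1 < p.2 ∧ σ p.2 < σ p.1)).card *
              ∏ i : Fin n, X (some (σ i, i))) + 2) + 1 := tau_jet_le_pencil n k
      _ ≤ (n + k + 2) ^ 2 * (a * (n + 1) ^ b + 2) + 1 := by gcongr; exact hab n
      _ ≤ (n + 2) ^ (a + b + 7) := bound_arith a b n k hk

end Summit.ValiantsHypothesis.ValiantsHypothesis.Theorems.AnyonJets.JetConstantElim

end
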